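import Mathlib
import Summits.Ventures.PercRepro2.Defs
import Summits.Ventures.PercRepro2.Harris
import Summits.Ventures.PercRepro2.Graph
import Summits.Ventures.PercRepro2.Events
import Summits.Ventures.PercRepro2.PsiPinInduction
import Summits.Ventures.PercRepro2.PsiUniSure
import Summits.Ventures.PercRepro2.PsiUniExplored
import Summits.Ventures.PercRepro2.PsiTEdge
import Summits.Ventures.PercRepro2.R21PinInduction
import Summits.Ventures.PercRepro2.R21OEdgeSGraph
import Summits.Ventures.PercRepro2.R21OEdgeS
import Summits.Ventures.PercRepro2.BHKAvoid
import Summits.Ventures.PercRepro2.R21OEdgeUPlus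
import Summits.Ventures.PercRepro2.CondHarrisAvoid
import Summits.Ventures.PercRepro2.R21OEdgeSPlusTransfer
import Summits.Ventures.PercRepro2.R21OEdgeSPlusMasses

/-!
# The edge to `s` of the `o`-exploration for the boundary derivative `R⁺` (PercRepro2, p2)

The `s`-edge case of (UNI-R⁺_o), `R⁺ = R + D_y`: for an unpinned edge `f = {x, s}` with `x` in the
explored `o`-component, in the closed-world cells,

  `T⁺_f − R⁺(p[f↦0]) − R⁺(p[f↦1]) = [BHK bracket] + [(c1) slack] + (13 nonnegative cell products)`,

where the BHK bracket `P(N,Y_o)·P(N,U_s) − P(N)·P(N,Y_o,U_s) ≥ 0` is `bhk_cross_cluster` for the roots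
`(o, s)` (as in `r21_uni_o_edge_s`) and the (c1) slack `P(a S D)·P(D) − P(a D)·P(S D) ≥ 0`,
`D = {C_o avoids {s, y}}`, is `harris_same_cluster_avoid`.  Hence `2·min(R⁺⁰, R⁺¹) ≤ R⁺⁰ + R⁺¹ ≤ T⁺_f`
with no induction hypothesis.  With `r21_pair_of_edge_cases` and `rplus_uni_o_edge_u` this leaves, of
the pair (R2-1) ∧ (R2-1⁺), only the far ends `z ∉ {s, y, u}`.
-/

namespace Summit.Ventures.PercRepro2

section SEdgePlus

variable {V : Type*} {E : Type*} [Fintype E] [DecidableEq E] [Fintype V] [DecidableEq V]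
  {R : Type*} [CommRing R] [LinearOrder R] [IsStrictOrderedRing R]

/-- **The `s`-edge case of (UNI-R⁺_o).** -/
theorem rplus_uni_o_edge_s (p : E → R) (hp : IsProbVec p) (ends : E → Sym2 V) (s y o u x : V) (f : E)
    (hf : ends f = s(x, s)) (hx : Conn ends (fun e => decide (p e = 1)) o x) (hpf : p f ≠ 1) :
    2 * min ((prob (Function.update p f 0) (connEvent ends s u ∩ clusterInEvent ends s {W : Set V | o ∈ W} ∩ (connEvent ends s y)ᶜ) + prob (Function.update p f 0) (connEvent ends s u ∩ connEvent ends y o ∩ (connEvent ends s y)ᶜ) + prob (Function.update p f 0) ((connEvent ends s y)ᶜ) * prob (Function.update p f 0) (connEvent ends s u ∩ clusterInEvent ends s {W : Set V | o ∈ W}) - (prob (Function.update p f 0) (connEvent ends s u ∩ (connEvent ends s y)ᶜ) * prob (Function.update p f 0) (clusterInEvent ends s {W : Set V | o ∈ W}) + prob (Function.update p f 0) (clusterInEvent ends s {W : Set V | o ∈ W} ∩ (connEvent ends s y)ᶜ) * prob (Function.update p f 0) (connEvent ends s u) + prob (Function.update p f 0) (connEvent ends y o ∩ (connEvent ends s y)ᶜ)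 * prob (Function.update p f 0) (connEvent ends s u))) + ((prob (Function.update p f 0) ((connEvent ends s u)ᶜ ∩ connEvent ends s o ∩ connEvent ends y u) + prob (Function.update p f 0) ((connEvent ends s u)ᶜ ∩ connEvent ends s y ∩ connEvent ends o u)) * prob (Function.update p f 0) ((connEvent ends s y)ᶜ ∩ (connEvent ends s o)ᶜ ∩ (connEvent ends y o)ᶜ) + prob (Function.update p f 0) (connEvent ends s o ∩ (connEvent ends s y)ᶜ) * prob (Function.update p f 0) ((connEvent ends s o)ᶜ ∩ connEvent ends s y ∩ connEvent ends s u) - prob (Function.update p f 0) (connEvent ends s u ∩ connEvent ends s o ∩ (connEvent ends s y)ᶜ) * prob (Function.update p f 0) ((connEvent ends s o)ᶜ ∩ connEvent ends s y))) ((prob (Function.update p f 1) (connEvent ends s u ∩ clusterInEvent ends s {W : Set V | o ∈ W} ∩ (connEvent ends s y)ᶜ) + prob (Function.update p f 1) (connEvent ends s u ∩ connEvent ends y o ∩ (connEvent ends s y)ᶜ) + prob (Function.update p f 1) ((connEvent ends s y)ᶜ) * prob (Function.update p f 1) (connEvent ends s u ∩ clusterInEvent ends s {W : Set V | o ∈ W})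 - (prob (Function.update p f 1) (connEvent ends s u ∩ (connEvent ends s y)ᶜ) * prob (Function.update p f 1) (clusterInEvent ends s {W : Set V | o ∈ W}) + prob (Function.update p f 1) (clusterInEvent ends s {W : Set V | o ∈ W} ∩ (connEvent ends s y)ᶜ) * prob (Function.update p f 1) (connEvent ends s u) + prob (Function.update p f 1) (connEvent ends y o ∩ (connEvent ends s y)ᶜ) * prob (Function.update p f 1) (connEvent ends s u))) + ((prob (Function.update p f 1) ((connEvent ends s u)ᶜ ∩ connEvent ends s o ∩ connEvent ends y u) + prob (Function.update p f 1) ((connEvent ends s u)ᶜ ∩ connEvent ends s y ∩ connEvent ends o u)) * prob (Function.update p f 1) ((connEvent ends s y)ᶜ ∩ (connEvent ends s o)ᶜ ∩ (connEvent ends y o)ᶜ) + prob (Function.update p f 1) (connEvent ends s o ∩ (connEvent ends s y)ᶜ) * prob (Function.update p f 1) ((connEvent ends s o)ᶜ ∩ connEvent ends s y ∩ connEvent ends s u) - prob (Function.update p f 1) (connEvent ends s u ∩ connEvent ends s o ∩ (connEvent ends s y)ᶜ) * prob (Function.update p f 1) ((connEvent ends s o)ᶜ ∩ connEvent ends s y)))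 ≤ (prob (Function.update p f 0) (connEvent ends s u ∩ clusterInEvent ends s {W : Set V | o ∈ W} ∩ (connEvent ends s y)ᶜ) + prob (Function.update p f 1) (connEvent ends s u ∩ clusterInEvent ends s {W : Set V | o ∈ W} ∩ (connEvent ends s y)ᶜ) + prob (Function.update p f 0) (connEvent ends s u ∩ connEvent ends y o ∩ (connEvent ends s y)ᶜ) + prob (Function.update p f 1) (connEvent ends s u ∩ connEvent ends y o ∩ (connEvent ends s y)ᶜ) + prob (Function.update p f 0) ((connEvent ends s y)ᶜ) * prob (Function.update p f 1) (connEvent ends s u ∩ clusterInEvent ends s {W : Set V | o ∈ W}) + prob (Function.update p f 1) ((connEvent ends s y)ᶜ) * prob (Function.update p f 0) (connEvent ends s u ∩ clusterInEvent ends s {W : Set V | o ∈ W}) - (prob (Function.update p f 0) (connEvent ends s u ∩ (connEvent ends s y)ᶜ) * prob (Function.update p f 1) (clusterInEvent ends s {W : Set V | o ∈ W}) + prob (Function.update p f 1) (connEvent ends s u ∩ (connEvent ends s y)ᶜ) * prob (Function.update p f 0) (clusterInEvent ends s {W : Set V | o ∈ W}) + prob (Function.update p f 0) (clusterInEvent ends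 s {W : Set V | o ∈ W} ∩ (connEvent ends s y)ᶜ) * prob (Function.update p f 1) (connEvent ends s u) + prob (Function.update p f 1) (clusterInEvent ends s {W : Set V | o ∈ W} ∩ (connEvent ends s y)ᶜ) * prob (Function.update p f 0) (connEvent ends s u) + prob (Function.update p f 0) (connEvent ends y o ∩ (connEvent ends s y)ᶜ) * prob (Function.update p f 1) (connEvent ends s u) + prob (Function.update p f 1) (connEvent ends y o ∩ (connEvent ends s y)ᶜ) * prob (Function.update p f 0) (connEvent ends s u))) + (prob (Function.update p f 0) ((connEvent ends s u)ᶜ ∩ connEvent ends s o ∩ connEvent ends y u) * prob (Function.update p f 1) ((connEvent ends s y)ᶜ ∩ (connEvent ends s o)ᶜ ∩ (connEvent ends y o)ᶜ) + prob (Function.update p f 1) ((connEvent ends s u)ᶜ ∩ connEvent ends s o ∩ connEvent ends y u) * prob (Function.update p f 0) ((connEvent ends s y)ᶜ ∩ (connEvent ends s o)ᶜ ∩ (connEvent ends y o)ᶜ) + prob (Function.update p f 0) ((connEvent ends s u)ᶜ ∩ connEvent ends s y ∩ connEvent ends o u) * prob (Function.update p f 1) ((connEvent ends s y)ᶜ ∩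 (connEvent ends s o)ᶜ ∩ (connEvent ends y o)ᶜ) + prob (Function.update p f 1) ((connEvent ends s u)ᶜ ∩ connEvent ends s y ∩ connEvent ends o u) * prob (Function.update p f 0) ((connEvent ends s y)ᶜ ∩ (connEvent ends s o)ᶜ ∩ (connEvent ends y o)ᶜ) + prob (Function.update p f 0) (connEvent ends s o ∩ (connEvent ends s y)ᶜ) * prob (Function.update p f 1) ((connEvent ends s o)ᶜ ∩ connEvent ends s y ∩ connEvent ends s u) + prob (Function.update p f 1) (connEvent ends s o ∩ (connEvent ends s y)ᶜ) * prob (Function.update p f 0) ((connEvent ends s o)ᶜ ∩ connEvent ends s y ∩ connEvent ends s u) - prob (Function.update p f 0) (connEvent ends s u ∩ connEvent ends s o ∩ (connEvent ends s y)ᶜ) * prob (Function.update p f 1) ((connEvent ends s o)ᶜ ∩ connEvent ends s y) - prob (Function.update p f 1) (connEvent ends s u ∩ connEvent ends s o ∩ (connEvent ends s y)ᶜ) * prob (Function.update p f 0) ((connEvent ends s o)ᶜ ∩ connEvent ends s y)) := by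
  classical
  have hq : IsProbVec (Function.update p f 0) := hp.update f le_rfl zero_le_one
  obtain ⟨t1, t2, t3, t4, t5, t6, t7, t8, t9⟩ := sEdge_transfer p ends s y o u x f hf hx hpf
  obtain ⟨z1, z2, z3, z4, z5, z6, z7⟩ := sEdge_dy_transfer p ends s y o u x f hf hx hpf
  obtain ⟨d1, d2, d3, d4, d5, d6, d7, d8, d9, da, db, dc⟩ :=
    sEdge_masses (Function.update p f 0) ends s y o u
  obtain ⟨r1, r2, r3, r4, r5, r6, r7, r8, r9, r10, r11, r12, r13, r14, r15, r16⟩ :=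
    sEdge_dy_masses (Function.update p f 0) ends s y o u
  -- the conditional Harris inequality (c1) for the roots `(o, s)`, avoiding `{s, y}`
  have hc1 := harris_same_cluster_avoid (Function.update p f 0) hq ends o s
    (X := {s, y}) (by simp) (isUpperSet_memFamily_ycl u) (isUpperSet_memFamily_ycl y)
  have hUV : clusterInEvent ends s ({W : Set V | u ∈ W} ∩ {W : Set V | y ∈ W}) =
      connEvent ends s u ∩ connEvent ends s y := by
    ext ω
    simp [clusterInEvent, cluster, connEvent]
  have havoid : avoidAll ends o {s, y} = (connEvent ends o s)ᶜ ∩ (connEvent ends o y)ᶜ := by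
    ext ω
    simp only [mem_avoidAll, Finset.mem_insert, Finset.mem_singleton, Set.mem_inter_iff,
      Set.mem_compl_iff, mem_connEvent]
    constructor
    · intro h
      exact ⟨h s (Or.inl rfl), h y (Or.inr rfl)⟩
    · rintro ⟨hs, hy⟩ v hv
      rcases hv with rfl | rfl
      · exact hs
      · exact hy
  rw [clusterInEvent_mem_eq_connEvent_ycl, clusterInEvent_mem_eq_connEvent_ycl, hUV, havoid] at hc1
  rw [r13, r14, r15, r16] at hc1
  -- the cross-cluster inequality for the roots `(o, s)` (the BHK bracket of `r21_uni_o_edge_s`)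
  have hbhk := bhk_cross_cluster (Function.update p f 0) hq ends o s
    (isUpperSet_memFamily_ycl y) (isUpperSet_memFamily_ycl u)
  rw [clusterInEvent_mem_eq_connEvent_ycl, clusterInEvent_mem_eq_connEvent_ycl] at hbhk
  have e4 : connEvent ends o y ∩ connEvent ends s u ∩ (connEvent ends o s)ᶜ =
      (connEvent ends o s)ᶜ ∩ connEvent ends o y ∩ connEvent ends s u := by
    ext ω; simp only [Set.mem_inter_iff]; tauto
  have e5 : connEvent ends o y ∩ (connEvent ends o s)ᶜ = (connEvent ends o s)ᶜ ∩ connEvent ends o y :=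
    Set.inter_comm _ _
  have e6 : connEvent ends s u ∩ (connEvent ends o s)ᶜ = (connEvent ends o s)ᶜ ∩ connEvent ends s u :=
    Set.inter_comm _ _
  rw [e4, e5, e6] at hbhk
  -- the goal in the atoms
  rw [t1, t2, t3, t4, t5, t6, t7, t8, t9, z1, z2, z3, z4, z5, z6, z7,
    d1, d2, d3, d4, d5, d6, d7, d8, d9, da, db, dc, r6, r7, r8, r9, r10, r11, r12]
  rw [r4] at hbhk
  rw [r4]
  rw [r3] at hbhk
  rw [r3]
  rw [r2] at hbhk
  rw [r2]
  rw [r5] at hbhk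
  rw [r5]
  rw [r1]
  rw [r2, r5] at hc1
  refine two_mul_min_le_of_add_le ?_
  have hC1 := prob_nonneg hq (connEvent ends o s ∩ (connEvent ends s y)ᶜ ∩ connEvent ends s u)
  have hC2 := prob_nonneg hq (connEvent ends o s ∩ (connEvent ends s y)ᶜ)
  have hC3 := prob_nonneg hq (connEvent ends o s ∩ connEvent ends s u)
  have hM1 := prob_nonneg hq ((connEvent ends o s)ᶜ ∩ ((connEvent ends s y)ᶜ ∩ (connEvent ends o y)ᶜ) ∩ connEvent ends o u)
  have hM4 := prob_nonneg hq ((connEvent ends o s)ᶜ ∩ connEvent ends o y ∩ connEvent ends s u)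
  have hM6 := prob_nonneg hq ((connEvent ends o s)ᶜ ∩ connEvent ends s u)
  have hM7 := prob_nonneg hq ((connEvent ends o s)ᶜ ∩ ((connEvent ends s y)ᶜ ∩ (connEvent ends o y)ᶜ) ∩ connEvent ends s u)
  have hK1 := prob_nonneg hq ((connEvent ends o s)ᶜ ∩ connEvent ends s y ∩ (connEvent ends s u)ᶜ ∩ (connEvent ends o u)ᶜ)
  have hK3 := prob_nonneg hq ((connEvent ends o s)ᶜ ∩ connEvent ends s y ∩ (connEvent ends s u)ᶜ ∩ connEvent ends o u)
  have hK5 := prob_nonneg hq ((connEvent ends o s)ᶜ ∩ connEvent ends s y ∩ connEvent ends s u)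
  have hZ1 := prob_nonneg hq ((connEvent ends o s)ᶜ ∩ connEvent ends o y ∩ (connEvent ends s u)ᶜ ∩ connEvent ends o u)
  have hZ2 := prob_nonneg hq ((connEvent ends o s)ᶜ ∩ ((connEvent ends s y)ᶜ ∩ (connEvent ends o y)ᶜ) ∩ (connEvent ends o u)ᶜ ∩ (connEvent ends s u)ᶜ ∩ (connEvent ends y u)ᶜ)
  have hZ3 := prob_nonneg hq ((connEvent ends o s)ᶜ ∩ connEvent ends o y ∩ (connEvent ends s u)ᶜ ∩ (connEvent ends o u)ᶜ)
  have hG := prob_nonneg hq ((connEvent ends o s)ᶜ ∩ ((connEvent ends s y)ᶜ ∩ (connEvent ends o y)ᶜ) ∩ (connEvent ends o u)ᶜ ∩ (connEvent ends s u)ᶜ ∩ connEvent ends y u)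
  have hA := prob_nonneg hq ((connEvent ends s u)ᶜ ∩ connEvent ends s o ∩ connEvent ends y u)
  generalize prob (Function.update p f 0) (connEvent ends o s ∩ (connEvent ends s y)ᶜ ∩ connEvent ends s u) = vC1 at hC1 ⊢
  generalize prob (Function.update p f 0) (connEvent ends o s ∩ (connEvent ends s y)ᶜ) = vC2 at hC2 ⊢
  generalize prob (Function.update p f 0) (connEvent ends o s ∩ connEvent ends s u) = vC3 at hC3 ⊢
  generalize prob (Function.update p f 0) ((connEvent ends o s)ᶜ ∩ ((connEvent ends s y)ᶜ ∩ (connEvent ends o y)ᶜ) ∩ connEvent ends o u) = vM1 at hM1 hbhk hc1 ⊢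
  generalize prob (Function.update p f 0) ((connEvent ends o s)ᶜ ∩ connEvent ends o y ∩ connEvent ends s u) = vM4 at hM4 hbhk ⊢
  generalize prob (Function.update p f 0) ((connEvent ends o s)ᶜ ∩ connEvent ends s u) = vM6 at hM6 hbhk ⊢
  generalize prob (Function.update p f 0) ((connEvent ends o s)ᶜ ∩ ((connEvent ends s y)ᶜ ∩ (connEvent ends o y)ᶜ) ∩ connEvent ends s u) = vM7 at hM7 hbhk hc1 ⊢
  generalize prob (Function.update p f 0) ((connEvent ends o s)ᶜ ∩ connEvent ends s y ∩ (connEvent ends s u)ᶜ ∩ (connEvent ends o u)ᶜ) = vK1 at hK1 hbhk hc1 ⊢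
  generalize prob (Function.update p f 0) ((connEvent ends o s)ᶜ ∩ connEvent ends s y ∩ (connEvent ends s u)ᶜ ∩ connEvent ends o u) = vK3 at hK3 hbhk hc1 ⊢
  generalize prob (Function.update p f 0) ((connEvent ends o s)ᶜ ∩ connEvent ends s y ∩ connEvent ends s u) = vK5 at hK5 hbhk hc1 ⊢
  generalize prob (Function.update p f 0) ((connEvent ends o s)ᶜ ∩ connEvent ends o y ∩ (connEvent ends s u)ᶜ ∩ connEvent ends o u) = vZ1 at hZ1 hbhk ⊢
  generalize prob (Function.update p f 0) ((connEvent ends o s)ᶜ ∩ ((connEvent ends s y)ᶜ ∩ (connEvent ends o y)ᶜ) ∩ (connEvent ends o u)ᶜ ∩ (connEvent ends s u)ᶜ ∩ (connEvent ends y u)ᶜ) = vZ2 at hZ2 hbhk hc1 ⊢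
  generalize prob (Function.update p f 0) ((connEvent ends o s)ᶜ ∩ connEvent ends o y ∩ (connEvent ends s u)ᶜ ∩ (connEvent ends o u)ᶜ) = vZ3 at hZ3 hbhk ⊢
  generalize prob (Function.update p f 0) ((connEvent ends o s)ᶜ ∩ ((connEvent ends s y)ᶜ ∩ (connEvent ends o y)ᶜ) ∩ (connEvent ends o u)ᶜ ∩ (connEvent ends s u)ᶜ ∩ connEvent ends y u) = vG at hG hbhk hc1 ⊢
  generalize prob (Function.update p f 0) ((connEvent ends s u)ᶜ ∩ connEvent ends s o ∩ connEvent ends y u) = vA at hA ⊢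
  have key : ((vC1 + (vM7 + vM1 + vC1) + vM4 + 0 + ((vM1 + vM7 + vG + vZ2) + (vM4 + vZ3 + vZ1) + vC2) * (vM6 + (vM1 + vZ1 + vK3) + vC3) + ((vM1 + vM7 + vG + vZ2) + vC2) * vC3 - ((vM7 + vM4 + vC1) * 1 + (vM7 + vM1 + vC1) * (1 - ((vM1 + vM7 + vG + vZ2) + (vM4 + vZ3 + vZ1) + (vK1 + vK3 + vK5))) + vC2 * (vM6 + (vM1 + vZ1 + vK3) + vC3) + ((vM1 + vM7 + vG + vZ2) + vC2) * (vM6 + vC3) + (vM4 + vZ3 + vZ1) * (vM6 + (vM1 + vZ1 + vK3) + vC3) + 0 * (vM6 + vC3))) + (vA * 0 + (vG + vA) * (vM1 + vM7 + vG + vZ2) + vK3 * 0 + 0 * (vM1 + vM7 + vG + vZ2) + vC2 * 0 + ((vM1 + vM7 + vG + vZ2) + vC2) * vK5 - vC1 * 0 - (vM7 + vM1 + vC1) * (vK1 + vK3 + vK5))) - (((vC1 + vM4 + ((vM1 + vM7 + vG + vZ2) + (vM4 + vZ3 + vZ1) + vC2) * vC3 - ((vM7 + vM4 + vC1) * (1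 - ((vM1 + vM7 + vG + vZ2) + (vM4 + vZ3 + vZ1) + (vK1 + vK3 + vK5))) + vC2 * (vM6 + vC3) + (vM4 + vZ3 + vZ1) * (vM6 + vC3))) + ((vA + vK3) * (vM1 + vM7 + vG + vZ2) + vC2 * vK5 - vC1 * (vK1 + vK3 + vK5))) + (((vM7 + vM1 + vC1) + 0 + ((vM1 + vM7 + vG + vZ2) + vC2) * (vM6 + (vM1 + vZ1 + vK3) + vC3) - ((vM7 + vM1 + vC1) * 1 + ((vM1 + vM7 + vG + vZ2) + vC2) * (vM6 + (vM1 + vZ1 + vK3) + vC3) + 0 * (vM6 + (vM1 + vZ1 + vK3) + vC3))) + (((vG + vA) + 0) * 0 + ((vM1 + vM7 + vG + vZ2) + vC2) * 0 - (vM7 + vM1 + vC1) * 0))) =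
      ((vM4 + vZ3 + vZ1) * vM6 - ((vM1 + vM7 + vG + vZ2) + (vM4 + vZ3 + vZ1) + (vK1 + vK3 + vK5)) * vM4) + (vK5 * ((vM1 + vM7 + vG + vZ2) + (vK1 + vK3 + vK5)) - (vM7 + vK5) * (vK1 + vK3 + vK5)) + (vZ1 * (2 * vM1 + vM7 + vZ2 + vG) + vM1 * (2 * vM7 + 2 * vZ2 + 3 * vG + vM4 + vZ3 + 2 * vM1) + vG * (vM7 + vZ2 + vG)) := by
    ring
  have hP1 : 0 ≤ vZ1 * (2 * vM1 + vM7 + vZ2 + vG) :=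
    mul_nonneg hZ1 (add_nonneg (add_nonneg (add_nonneg (mul_nonneg zero_le_two hM1) hM7) hZ2) hG)
  have hP2 : 0 ≤ vM1 * (2 * vM7 + 2 * vZ2 + 3 * vG + vM4 + vZ3 + 2 * vM1) :=
    mul_nonneg hM1 (add_nonneg (add_nonneg (add_nonneg (add_nonneg (add_nonneg (mul_nonneg zero_le_two hM7)
      (mul_nonneg zero_le_two hZ2)) (mul_nonneg (by norm_num) hG)) hM4) hZ3) (mul_nonneg zero_le_two hM1))
  have hP3 : 0 ≤ vG * (vM7 + vZ2 + vG) := mul_nonneg hG (add_nonneg (add_nonneg hM7 hZ2) hG)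
  linarith [key, hbhk, hc1, hP1, hP2, hP3]
end SEdgePlus

end Summit.Ventures.PercRepro2
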